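import Summits.QuantumFields.BalabanUV.Beta.D1BFx.TwoPointLegRows
import Summits.QuantumFields.BalabanUV.Beta.D1BFx.TwoPointFrozen
import Summits.QuantumFields.BalabanUV.Beta.D1BFx.FineHessianLegGrades

/-!
# `BalabanUV.Beta.D1BFx.TwoPointLegPieces` — road «BF-x» for binder row D1, «A3.c ∕ L-X TAILS» PART II (I2): the THREE LEG PIECES
# `legPiece 0 = frozenLeg g`, `legPiece 1 = diagPart Ga − frozenLeg g`, `legPiece 2 = offPart Ga` as two-point legs — per fibre entry and per list
# of static ∕ moving end steps: the FAR soft row (exponent `2 + min k 1`), the FLAT window row (`n^{−(2 + min k 1)}`), the free part (piece 0 only)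

HONEST DEPENDENCY (page 1, mandatory): continuum YM on T⁴ ⇐ BetaPertH ∧ nine spine estimates (0/9 proved); BetaPertH ⇐ (D1) ∧ (D4) ∧
CAP+tail; G-an2-4 gates asym, D1 and NE2/3/4.  HONEST FRAMING (cell contract, verbatim): «discharging `BetaPertH` makes Bałaban's UV
stability UNCONDITIONAL — a real constructive-QFT result; it is NOT the continuum limit and NOT the Clay problem.»  THIS MODULE DISCHARGES
NOTHING of the wall: [folklore] composition BY NAME of part (G) `TwoPointLegRows` (entry rows in, soft slice bounds out), part (I1) `TwoPointFrozen`,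
part (C2) `ScaleLegTermBound` (`abs_iterD_far_le`, `abs_iterD_flat_le`, `exists_soft_iterD_free`), leaf-08's `DiagonalLegGrade` ∕ `OffDiagonalLegGrade`
window grades (theorems), `VectorPropagatorLimit.Kinf_symm`.  The entry rows of `K^∞` and the rows of the profile `g` are HYPOTHESES in the END's shape
(discharged in part (J) from the printed `h12`∕`h126` and `FrozenLegProfile`); no `def`, no `Prop` minted, nothing cited anew, 0 sorry.  0 wall binders;
NOT an A3.c row, NOT (K), NOT D1, NOT `BetaPertH`, NOT continuum, NOT Clay.

ABSOLUTE RULE (cell charter, verbatim): «No internally-minted statement may enter as a cited fact. Every hypothesis is either kernel-proved in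
this package or a verbatim quotation of a PUBLISHED theorem with page reference. The manuscript(s) under audit are NOT citable for their own
disputed steps — they are the thing under adjudication; programme-internal (2001/route/tribunal) claims are never citable.»

WHY (this lineage's N-d1leaf03g12-2, journal l.30261; owner ρ-g9-32 (i) «PART II instantiates the tail module with the FLAT window grades of
`legPiece 1∕2`»): part (I3)'s driver reads each unfolded two-point term as `c·Λ₁(w + x₁)·Λ₂(w + x₂)` with `Λ(u) = itL sL (itR sR P) x₀ (x₀ + u)`,
`P` a fibre entry of a leg piece; this file supplies, for every such `Λ`, the three rows part (H)'s `weighted_term_bound` consumes, with constants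
FREE OF `n`, of the base points and of the fibre indices.
* §1 [folklore] the pieces' entries (`legPiece_two_entry_of_ne`, `…_self`, `legPiece_one_entry_self`, `…_of_ne`, `legPiece_zero_entry_*`), the
  transpose law `legPiece_transpose` (`Kinf_symm`, `g` even), `itL_itR_zero`.
* §2 [folklore] ENTRY TOOLS: `abs_Kinf_self_le` (value bound `Z = |G₀ 0| + D₀ + ellD0`), first-step flat bounds of the off-diagonal entry and of the
  diagonal flat kernel `K^∞_{κκ} − G₀`, `abs_itL_itR_le_of_first_step` (`2^k·M₁` for `k ≥ 1`).
* §3 [folklore] THE PACKAGES: **`far_two`∕`flat_two`**, **`far_one`∕`flat_one`**, **`far_zero`∕`split_zero`**, and `envelope_of_soft`.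
Unit `b2b-balaban-beta-d1-formalise-leaf-03` (gen 12), D1 formalisation swarm; `LEAVES-BFx.md` row «A3.c ∕ L-X TAILS» PART II (I2).
-/

noncomputable section
namespace Summit.QuantumFields.BalabanUV.Beta.D1BFx.TwoPointLegPieces

open Literature.MathematicalPhysics.QuantumFieldTheory.Balaban1983to89 Literature.MathematicalPhysics.QuantumFieldTheory.Balaban1983to89.Beta
open B12Sec2to5 (l1)
open ExpKernelCalculus (Site MKer)
open DyadicShell (Pt supNorm)
open BubbleTransfer (unitVec)
open GhostTable (gFree)
open PoissonInterior (G₀)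
open TwoPowerLegs (free)
open LongitudinalWindow (ellD0 ellD1)
open WoodburyCovariant (woodburyDc woodburyD1c)
open VectorPropagatorLimit (Kinf Kinf_symm)
open GradedBubbles (Fam iterD IsStep)
open ScaleLegRows (exp_supNorm_le_exp_l1)
open ScaleLegTermBound (abs_iterD_far_le abs_iterD_flat_le exists_soft_iterD_free iterD_const_eq_free_add_flat)
open TwoPointEnds (SKer itL itR itL_sub itR_sub)
open TwoPointLegRows (abs_itL_itR_slice_le)
open TwoPointFrozen (abs_itL_itR_le_of_sup abs_itL_le_of_sup abs_itR_le_of_sup itL_itR_transl steps_append_neg)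
open Summit.QuantumFields.BalabanUV.Beta.D1BFx.GluonLeg (Ga Ga_apply)
open Summit.QuantumFields.BalabanUV.Beta.D1BFx.FineHessianLegGrades (legPiece diagPart offPart frozenLeg legPiece_zero legPiece_one legPiece_two)
open Summit.QuantumFields.BalabanUV.Beta.D1BFx.DiagonalLegGrade (abs_Kinf_diag_sub_G₀_le abs_Kinf_diag_flat_sub_left_le abs_Kinf_diag_flat_sub_right_le)
open Summit.QuantumFields.BalabanUV.Beta.D1BFx.OffDiagonalLegGrade (abs_Kinf_offDiag_le_four abs_Kinf_offDiag_sub_base_le_four abs_Kinf_offDiag_sub_disp_le_four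
  ellD0_nonneg ellD1_nonneg)

variable {n : ℕ} [NeZero n] {a : ℝ} {g : Pt → ℝ}

/-! ## §1 The entries of the three pieces; transpose; the zero kernel -/

/-- [folklore] Off-diagonal piece, off-diagonal entry: the entry of `K^∞`. -/
theorem legPiece_two_entry_of_ne {κ l : Fin 4} (h : κ ≠ l) :
    (fun x y : Pt => legPiece n a g 2 x y κ l) = fun x y => Kinf n a (x, κ) (y, l) := by
  funext x y; rw [FineHessianLegGrades.legPiece_two_apply_of_ne n a g h, Ga_apply]

/-- [folklore] Off-diagonal piece, diagonal entry: zero. -/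
theorem legPiece_two_entry_self (κ : Fin 4) : (fun x y : Pt => legPiece n a g 2 x y κ κ) = fun _ _ => 0 := by
  funext x y; simp [legPiece_two, offPart]

/-- [folklore] Diagonal-minus-frozen piece, diagonal entry: `K^∞_{κκ}(x, y) − g (y − x)`. -/
theorem legPiece_one_entry_self (κ : Fin 4) :
    (fun x y : Pt => legPiece n a g 1 x y κ κ) = fun x y => Kinf n a (x, κ) (y, κ) - g (y - x) := by
  funext x y; rw [FineHessianLegGrades.legPiece_one_apply_self, Ga_apply]

/-- [folklore] Diagonal-minus-frozen piece, off-diagonal entry: zero. -/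
theorem legPiece_one_entry_of_ne {κ l : Fin 4} (h : κ ≠ l) : (fun x y : Pt => legPiece n a g 1 x y κ l) = fun _ _ => 0 := by
  funext x y; simp [legPiece_one, diagPart, frozenLeg, h]

/-- [folklore] Frozen piece, diagonal entry: `g (y − x)`. -/
theorem legPiece_zero_entry_self (κ : Fin 4) : (fun x y : Pt => legPiece n a g 0 x y κ κ) = fun x y => g (y - x) := by
  funext x y; simp [legPiece_zero, frozenLeg]

/-- [folklore] Frozen piece, off-diagonal entry: zero. -/
theorem legPiece_zero_entry_of_ne {κ l : Fin 4} (h : κ ≠ l) : (fun x y : Pt => legPiece n a g 0 x y κ l) = fun _ _ => 0 := by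
  funext x y; simp [legPiece_zero, frozenLeg, h]

/-- [folklore] **THE TRANSPOSE LAW**: every piece is symmetric under `(x, κ) ↔ (y, l)` (`K^∞` is symmetric, `g` is even). -/
theorem legPiece_transpose (hn : 1 ≤ n) (ha : 0 < a) (hg : ∀ w, g (-w) = g w) (r : Fin 3) (x y : Pt) (κ l : Fin 4) :
    legPiece n a g r y x l κ = legPiece n a g r x y κ l := by
  have hK : ∀ κ l, Kinf n a (y, l) (x, κ) = Kinf n a (x, κ) (y, l) := fun κ l => Kinf_symm n hn a ha (by norm_num) (y, l) (x, κ)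
  have hgxy : g (x - y) = g (y - x) := by rw [← hg (x - y), neg_sub]
  fin_cases r
  · show legPiece n a g 0 y x l κ = legPiece n a g 0 x y κ l
    simp only [legPiece_zero, frozenLeg]
    by_cases h : l = κ
    · subst h; simp [hgxy]
    · simp [h, Ne.symm h]
  · show legPiece n a g 1 y x l κ = legPiece n a g 1 x y κ l
    simp only [legPiece_one, Pi.sub_apply, diagPart, frozenLeg, Ga_apply]
    by_cases h : l = κ
    · subst h; simp [hK, hgxy]
    · simp [h, Ne.symm h]
  · show legPiece n a g 2 y x l κ = legPiece n a g 2 x y κ l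
    simp only [legPiece_two, offPart, Ga_apply]
    by_cases h : l = κ
    · subst h; simp
    · simp [h, Ne.symm h, hK]

omit [NeZero n] in
/-- [folklore] End steps of the zero kernel vanish. -/
theorem itL_itR_zero (sL sR : List Pt) (x y : Pt) : itL sL (itR sR (fun _ _ => (0 : ℝ))) x y = 0 := by
  have h := abs_itL_itR_le_of_sup (K := fun _ _ => (0 : ℝ)) (M := 0) (fun _ _ => by simp) sL sR x y
  rw [mul_zero] at h
  exact abs_eq_zero.mp (le_antisymm h (abs_nonneg _))

/-! ## §2 Entry tools -/

section Entry

variable (hn : 1 ≤ n) (ha : 0 < a)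
include hn ha

/-- [folklore] **THE VALUE OF EVERY ENTRY ON THE DIAGONAL OF SITES**: `|K^∞((x,κ),(x,l))| ≤ |G₀ 0| + (woodburyDc 0 + ellD0 4 a) + ellD0 4 a`
(diagonal fibre: the free value up to the flat `D₀/n²`; off-diagonal fibre: the flat `ellD0/n²`). -/
theorem abs_Kinf_self_le (x : Pt) (κ l : Fin 4) : |Kinf n a (x, κ) (x, l)| ≤ |G₀ (0 : Pt)| + (woodburyDc 0 + ellD0 4 a) + ellD0 4 a := by
  have hn1 : (1 : ℝ) ≤ (n : ℝ) ^ 2 := one_le_pow₀ (by exact_mod_cast hn)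
  have hD : 0 ≤ woodburyDc 0 + ellD0 4 a := add_nonneg VectorLegVolumeAdapter.woodburyDc_zero_nonneg (ellD0_nonneg ha)
  have hE : 0 ≤ ellD0 4 a := ellD0_nonneg ha
  by_cases h : κ = l
  · subst h
    have h1 := abs_Kinf_diag_sub_G₀_le n hn ha κ x x
    rw [sub_self] at h1
    have h2 : |Kinf n a (x, κ) (x, κ) - G₀ 0| ≤ woodburyDc 0 + ellD0 4 a := h1.trans (div_le_self hD hn1)
    have := abs_sub_abs_le_abs_sub (Kinf n a (x, κ) (x, κ)) (G₀ (0 : Pt))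
    linarith
  · have h1 := abs_Kinf_offDiag_le_four n hn ha h x 0
    rw [add_zero] at h1
    exact (h1.trans (div_le_self hE hn1)).trans (by linarith [abs_nonneg (G₀ (0 : Pt))])

/-- [folklore] One MOVING step of an off-diagonal entry is flat of size `ellD1/n³` (both orientations). -/
theorem abs_offDiag_dR_le {κ l : Fin 4} (h : κ ≠ l) (x y : Pt) {e : Pt} (he : IsStep e) :
    |Kinf n a (x, κ) (y + e, l) - Kinf n a (x, κ) (y, l)| ≤ ellD1 4 a / (n : ℝ) ^ 3 := by
  obtain ⟨ρ, rfl | rfl⟩ := he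
  · have h1 := abs_Kinf_offDiag_sub_disp_le_four n hn ha h ρ x (y - x)
    rwa [show x + (y - x) = y by abel] at h1
  · have h1 := abs_Kinf_offDiag_sub_disp_le_four n hn ha h ρ x (y + -unitVec ρ - x)
    rw [show x + (y + -unitVec ρ - x) = y + -unitVec ρ by abel, show y + -unitVec ρ + Pi.single ρ 1 = y from by
      rw [BubbleTransfer.unitVec]; abel, abs_sub_comm] at h1
    exact h1

/-- [folklore] One STATIC step of an off-diagonal entry is flat of size `ellD1/n³` (both orientations). -/
theorem abs_offDiag_dL_le {κ l : Fin 4} (h : κ ≠ l) (x y : Pt) {e : Pt} (he : IsStep e) :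
    |Kinf n a (x + e, κ) (y, l) - Kinf n a (x, κ) (y, l)| ≤ ellD1 4 a / (n : ℝ) ^ 3 := by
  obtain ⟨ρ, rfl | rfl⟩ := he
  · have h1 := abs_Kinf_offDiag_sub_base_le_four n hn ha h ρ x (y - x)
    rw [show x + (y - x) = y by abel] at h1; exact h1
  · have h1 := abs_Kinf_offDiag_sub_base_le_four n hn ha h ρ (x + -unitVec ρ) (y - (x + -unitVec ρ))
    rw [show x + -unitVec ρ + (y - (x + -unitVec ρ)) = y by abel, show x + -unitVec ρ + Pi.single ρ 1 = x from by
      rw [BubbleTransfer.unitVec]; abel, abs_sub_comm] at h1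
    exact h1

/-- [folklore] The diagonal FLAT kernel `K^∞_{κκ}(x,y) − G₀(y − x)`: value `≤ D₀/n²`. -/
theorem abs_diagFlat_le (κ : Fin 4) (x y : Pt) : |Kinf n a (x, κ) (y, κ) - G₀ (y - x)| ≤ (woodburyDc 0 + ellD0 4 a) / (n : ℝ) ^ 2 :=
  abs_Kinf_diag_sub_G₀_le n hn ha κ x y

/-- [folklore] … one MOVING step: `≤ D₁/n³` (both orientations). -/
theorem abs_diagFlat_dR_le (κ : Fin 4) (x y : Pt) {e : Pt} (he : IsStep e) :
    |(Kinf n a (x, κ) (y + e, κ) - G₀ (y + e - x)) - (Kinf n a (x, κ) (y, κ) - G₀ (y - x))| ≤ (woodburyD1c 0 + ellD1 4 a) / (n : ℝ) ^ 3 := by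
  obtain ⟨ρ, rfl | rfl⟩ := he
  · have h1 := abs_Kinf_diag_flat_sub_right_le n hn ha κ ρ x y
    rwa [BubbleTransfer.unitVec]
  · have h1 := abs_Kinf_diag_flat_sub_right_le n hn ha κ ρ x (y + -unitVec ρ)
    rw [show y + -unitVec ρ + Pi.single ρ 1 = y from by rw [BubbleTransfer.unitVec]; abel, abs_sub_comm] at h1
    exact h1

/-- [folklore] … one STATIC step: `≤ D₁/n³` (both orientations). -/
theorem abs_diagFlat_dL_le (κ : Fin 4) (x y : Pt) {e : Pt} (he : IsStep e) :
    |(Kinf n a (x + e, κ) (y, κ) - G₀ (y - (x + e))) - (Kinf n a (x, κ) (y, κ) - G₀ (y - x))| ≤ (woodburyD1c 0 + ellD1 4 a) / (n : ℝ) ^ 3 := by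
  obtain ⟨ρ, rfl | rfl⟩ := he
  · have h1 := abs_Kinf_diag_flat_sub_left_le n hn ha κ ρ x y
    rwa [BubbleTransfer.unitVec]
  · have h1 := abs_Kinf_diag_flat_sub_left_le n hn ha κ ρ (x + -unitVec ρ) y
    rw [show x + -unitVec ρ + Pi.single ρ 1 = x from by rw [BubbleTransfer.unitVec]; abel, abs_sub_comm] at h1
    exact h1

end Entry

omit [NeZero n] in
/-- [folklore] **FIRST STEP + DOUBLING**: if every single end step of `K` (either end, either orientation) is `≤ M₁` in sup, then for `k = |sL| + |sR| ≥ 1`,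
`|itL sL (itR sR K) x y| ≤ 2^k·M₁`. -/
theorem abs_itL_itR_le_of_first_step {K : SKer} {M₁ : ℝ} (hM : 0 ≤ M₁)
    (hR : ∀ (x y e : Pt), IsStep e → |K x (y + e) - K x y| ≤ M₁) (hL : ∀ (x y e : Pt), IsStep e → |K (x + e) y - K x y| ≤ M₁)
    {sL sR : List Pt} (hsL : ∀ e ∈ sL, IsStep e) (hsR : ∀ e ∈ sR, IsStep e) (hk : 1 ≤ sL.length + sR.length) (x y : Pt) :
    |itL sL (itR sR K) x y| ≤ 2 ^ (sL.length + sR.length) * M₁ := by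
  rcases sR with _ | ⟨e, sR'⟩
  · rcases sL with _ | ⟨e', sL'⟩
    · simp at hk
    · show |itL sL' (fun x y => K (x + e') y - K x y) x y| ≤ _
      have h1 := abs_itL_le_of_sup (K := fun x y => K (x + e') y - K x y) (M := M₁) (fun x y => hL x y e' (hsL e' (by simp))) sL' x y
      refine h1.trans ?_
      simp only [List.length_cons, List.length_nil, add_zero, pow_succ]
      linarith [show (0 : ℝ) ≤ 2 ^ sL'.length * M₁ by positivity]
  · show |itL sL (itR sR' (fun x y => K x (y + e) - K x y)) x y| ≤ _
    have h1 := abs_itL_itR_le_of_sup (K := fun x y => K x (y + e) - K x y) (M := M₁) (fun x y => hR x y e (hsR e (by simp))) sL sR' x y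
    refine h1.trans ?_
    simp only [List.length_cons, ← add_assoc, pow_succ]
    linarith [show (0 : ℝ) ≤ 2 ^ (sL.length + sR'.length) * M₁ by positivity]

/-! ## §3 The packages: far soft row, flat row, free part -/

section Packages

variable (hn : 1 ≤ n) {δ A₀ A₁ D₀ D₁ : ℝ} (ha : 0 < a)

/-- [folklore] A soft far bound in the sup norm gives the `ℓ¹` envelope needed for summability at fixed `n`. -/
theorem envelope_of_soft {Λ : Pt → ℝ} {B c : ℝ} (hB : 0 ≤ B) (hc : 0 ≤ c) {p : ℕ}
    (h : ∀ u : Pt, |Λ u| ≤ B * Real.exp (-c * supNorm u) / ((supNorm u : ℝ) + 1) ^ p) (u : Pt) :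
    |Λ u| ≤ B * Real.exp (-(c / 4) * l1 u) := by
  refine (h u).trans ?_
  have hden : (1 : ℝ) ≤ ((supNorm u : ℝ) + 1) ^ p := one_le_pow₀ (by have : (0:ℝ) ≤ supNorm u := Nat.cast_nonneg _; linarith)
  calc B * Real.exp (-c * supNorm u) / ((supNorm u : ℝ) + 1) ^ p ≤ B * Real.exp (-c * supNorm u) := div_le_self (by positivity) hden
    _ ≤ B * Real.exp (-(c / 4) * l1 u) := mul_le_mul_of_nonneg_left (exp_supNorm_le_exp_l1 hc u) hB

include hn

include ha in
/-- [folklore] **PIECE 2 (off-diagonal entries), FAR**: for `κ ≠ l`, unit `sL, sR`, `k = |sL| + |sR|`, every `x₀, u`: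
`|itL sL (itR sR (legPiece 2)_{κl}) x₀ (x₀ + u)| ≤ (5A₀ + 8A₁ + Z)·8e^δ(1+8e^δ)^k·E(u)/(‖u‖∞+1)^{2+min k 1}`, `Z = |G₀ 0| + D₀' + ellD0` —
from the entry rows d0∕d1 of `K^∞` (every base point, every fibre pair). -/
theorem far_two (hδ : 0 ≤ δ) (hA₀ : 0 ≤ A₀) (hA₁ : 0 ≤ A₁)
    (e0 : ∀ (x w : Pt) (κ l : Fin 4), w ≠ 0 → |Kinf n a (x, κ) (x + w, l)| ≤ A₀ * Real.exp (-(δ / n) * supNorm w) / (supNorm w : ℝ) ^ 2)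
    (e1 : ∀ (x w : Pt) (κ l : Fin 4), w ≠ 0 → ∀ ρ : Fin 4,
      |Kinf n a (x, κ) (x + w + unitVec ρ, l) - Kinf n a (x, κ) (x + w, l)| ≤ A₁ * Real.exp (-(δ / n) * supNorm w) / (supNorm w : ℝ) ^ 3)
    {κ l : Fin 4} (hκl : κ ≠ l) {sL sR : List Pt} (hsL : ∀ e ∈ sL, IsStep e) (hsR : ∀ e ∈ sR, IsStep e) (x₀ u : Pt) :
    |itL sL (itR sR (fun x y : Pt => legPiece n a g 2 x y κ l)) x₀ (x₀ + u)| ≤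
      (5 * A₀ + 8 * A₁ + (|G₀ (0 : Pt)| + (woodburyDc 0 + ellD0 4 a) + ellD0 4 a)) * (8 * Real.exp δ) * (1 + 2 ^ 3 * Real.exp δ) ^ (sL.length + sR.length) *
        Real.exp (-(δ / n) * supNorm u) / ((supNorm u : ℝ) + 1) ^ (2 + min (sL.length + sR.length) 1) := by
  rw [legPiece_two_entry_of_ne hκl]
  have hsymm : ∀ x y : Pt, ∀ κ' l' : Fin 4, Kinf n a (y, l') (x, κ') = Kinf n a (x, κ') (y, l') := fun x y κ' l' =>
    Kinf_symm n hn a ha (by norm_num) (y, l') (x, κ')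
  exact abs_itL_itR_slice_le hn hδ hA₀ hA₁ (K := fun x y => Kinf n a (x, κ) (y, l)) (fun x => abs_Kinf_self_le hn ha x κ l)
    (fun x v hv => e0 x v κ l hv) (fun x v hv ρ => e1 x v κ l hv ρ)
    (fun y v hv => by rw [hsymm y (y + v) l κ]; exact e0 y v l κ hv)
    (fun y v hv ρ => by rw [hsymm y (y + v + unitVec ρ) l κ, hsymm y (y + v) l κ]; exact e1 y v l κ hv ρ) hsL hsR x₀ u

include ha in
/-- [folklore] **PIECE 2, FLAT**: `|itL sL (itR sR (legPiece 2)_{κl}) x₀ (x₀+u)| ≤ (ellD0 + ellD1)·2^k/n^{2+min k 1}` (`κ ≠ l`). -/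
theorem flat_two {κ l : Fin 4} (hκl : κ ≠ l) {sL sR : List Pt} (hsL : ∀ e ∈ sL, IsStep e) (hsR : ∀ e ∈ sR, IsStep e) (x₀ u : Pt) :
    |itL sL (itR sR (fun x y : Pt => legPiece n a g 2 x y κ l)) x₀ (x₀ + u)| ≤
      (ellD0 4 a + ellD1 4 a) * 2 ^ (sL.length + sR.length) / (n : ℝ) ^ (2 + min (sL.length + sR.length) 1) := by
  rw [legPiece_two_entry_of_ne hκl]
  have hn0 : (0 : ℝ) < n := by exact_mod_cast hn
  have hE0 := ellD0_nonneg (d := 4) ha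
  have hE1 := ellD1_nonneg (d := 4) ha
  rcases Nat.eq_zero_or_pos (sL.length + sR.length) with hk | hk
  · have h1 : sL = [] := List.eq_nil_of_length_eq_zero (by omega)
    have h2 : sR = [] := List.eq_nil_of_length_eq_zero (by omega)
    subst h1; subst h2
    simp only [itL, itR, List.length_nil, add_zero, pow_zero, mul_one, Nat.min_eq_left (Nat.zero_le 1)]
    have h := abs_Kinf_offDiag_le_four n hn ha hκl x₀ u
    exact h.trans (div_le_div_of_nonneg_right (by linarith) (by positivity))
  · have hmin : min (sL.length + sR.length) 1 = 1 := by omega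
    rw [hmin]
    have h := abs_itL_itR_le_of_first_step (K := fun x y => Kinf n a (x, κ) (y, l)) (M₁ := ellD1 4 a / (n : ℝ) ^ 3) (by positivity)
      (fun x y e he => abs_offDiag_dR_le hn ha hκl x y he) (fun x y e he => abs_offDiag_dL_le hn ha hκl x y he) hsL hsR hk x₀ (x₀ + u)
    refine h.trans ?_
    rw [mul_div_assoc']
    exact div_le_div_of_nonneg_right (by nlinarith [pow_pos (two_pos : (0:ℝ) < 2) (sL.length + sR.length)]) (by positivity)

/-- [folklore] **PIECE 0 (frozen), FAR** (diagonal entry): the profile's rows d0∕d1∕h0 ⇒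
`|itL sL (itR sR (legPiece 0)_{κκ}) x₀ (x₀+u)| ≤ (5A₀ + 8A₁ + |gFree 0| + D₀)·8e^δ(1+8e^δ)^k·E(u)/(‖u‖∞+1)^{2+min k 1}`. -/
theorem far_zero (hδ : 0 ≤ δ) (hA₀ : 0 ≤ A₀) (hA₁ : 0 ≤ A₁)
    (d0 : ∀ v : Pt, v ≠ 0 → |g v| ≤ A₀ * Real.exp (-(δ / n) * supNorm v) / (supNorm v : ℝ) ^ 2)
    (d1 : ∀ v : Pt, v ≠ 0 → ∀ ρ : Fin 4, |g (v + unitVec ρ) - g v| ≤ A₁ * Real.exp (-(δ / n) * supNorm v) / (supNorm v : ℝ) ^ 3)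
    (h0 : ∀ v : Pt, |g v - gFree v| ≤ D₀ / (n : ℝ) ^ 2)
    (κ : Fin 4) {sL sR : List Pt} (hsL : ∀ e ∈ sL, IsStep e) (hsR : ∀ e ∈ sR, IsStep e) (x₀ u : Pt) :
    |itL sL (itR sR (fun x y : Pt => legPiece n a g 0 x y κ κ)) x₀ (x₀ + u)| ≤
      (5 * A₀ + 8 * A₁ + (|gFree 0| + D₀)) * (8 * Real.exp δ) * (1 + 2 ^ 3 * Real.exp δ) ^ (sL.length + sR.length) *
        Real.exp (-(δ / n) * supNorm u) / ((supNorm u : ℝ) + 1) ^ (2 + min (sL.length + sR.length) 1) := by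
  rw [legPiece_zero_entry_self, itL_itR_transl]
  obtain ⟨hst, hlen⟩ := steps_append_neg hsL hsR
  have h := abs_iterD_far_le hn hδ hA₀ hA₁ d0 d1 h0 hst u
  rw [hlen, show sR.length + sL.length = sL.length + sR.length by omega] at h
  exact h

/-- [folklore] **PIECE 0, WINDOW SPLIT**: free part + flat part, `itL sL (itR sR (legPiece 0)_{κκ}) x₀ (x₀+u) = F u + Φ u` with
`F = iterD (sR ++ sL.map neg) gFree` and `|Φ u| ≤ (D₀+D₁)2^k/n^{2+min k 1}`. -/
theorem split_zero (hD₁ : 0 ≤ D₁) (h0 : ∀ v : Pt, |g v - gFree v| ≤ D₀ / (n : ℝ) ^ 2)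
    (h1 : ∀ (v : Pt) (ρ : Fin 4), |(g (v + unitVec ρ) - gFree (v + unitVec ρ)) - (g v - gFree v)| ≤ D₁ / (n : ℝ) ^ 3)
    (κ : Fin 4) {sL sR : List Pt} (hsL : ∀ e ∈ sL, IsStep e) (hsR : ∀ e ∈ sR, IsStep e) (x₀ u : Pt) :
    itL sL (itR sR (fun x y : Pt => legPiece n a g 0 x y κ κ)) x₀ (x₀ + u) =
      iterD (sR ++ sL.map Neg.neg) free.g 0 0 u + iterD (sR ++ sL.map Neg.neg) (fun (_ : ℕ) (_ : ℕ) => fun v => g v - gFree v) 0 0 u ∧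
    |iterD (sR ++ sL.map Neg.neg) (fun (_ : ℕ) (_ : ℕ) => fun v => g v - gFree v) 0 0 u| ≤
      (D₀ + D₁) * 2 ^ (sL.length + sR.length) / (n : ℝ) ^ (2 + min (sL.length + sR.length) 1) := by
  rw [legPiece_zero_entry_self, itL_itR_transl]
  obtain ⟨hst, hlen⟩ := steps_append_neg hsL hsR
  refine ⟨iterD_const_eq_free_add_flat g _ 0 0 u, ?_⟩
  have h := abs_iterD_flat_le hn hD₁ h0 h1 hst u
  rw [hlen, show sR.length + sL.length = sL.length + sR.length by omega] at h
  exact h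

include ha in
/-- [folklore] **PIECE 1 (diagonal minus frozen), FAR** (diagonal entry): entry rows of `K^∞` + profile rows ⇒ the sum of the two far bounds. -/
theorem far_one (hδ : 0 ≤ δ) (hA₀ : 0 ≤ A₀) (hA₁ : 0 ≤ A₁)
    (e0 : ∀ (x w : Pt) (κ l : Fin 4), w ≠ 0 → |Kinf n a (x, κ) (x + w, l)| ≤ A₀ * Real.exp (-(δ / n) * supNorm w) / (supNorm w : ℝ) ^ 2)
    (e1 : ∀ (x w : Pt) (κ l : Fin 4), w ≠ 0 → ∀ ρ : Fin 4,
      |Kinf n a (x, κ) (x + w + unitVec ρ, l) - Kinf n a (x, κ) (x + w, l)| ≤ A₁ * Real.exp (-(δ / n) * supNorm w) / (supNorm w : ℝ) ^ 3)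
    (d0 : ∀ v : Pt, v ≠ 0 → |g v| ≤ A₀ * Real.exp (-(δ / n) * supNorm v) / (supNorm v : ℝ) ^ 2)
    (d1 : ∀ v : Pt, v ≠ 0 → ∀ ρ : Fin 4, |g (v + unitVec ρ) - g v| ≤ A₁ * Real.exp (-(δ / n) * supNorm v) / (supNorm v : ℝ) ^ 3)
    (h0 : ∀ v : Pt, |g v - gFree v| ≤ D₀ / (n : ℝ) ^ 2)
    (κ : Fin 4) {sL sR : List Pt} (hsL : ∀ e ∈ sL, IsStep e) (hsR : ∀ e ∈ sR, IsStep e) (x₀ u : Pt) :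
    |itL sL (itR sR (fun x y : Pt => legPiece n a g 1 x y κ κ)) x₀ (x₀ + u)| ≤
      ((5 * A₀ + 8 * A₁ + (|G₀ (0 : Pt)| + (woodburyDc 0 + ellD0 4 a) + ellD0 4 a)) * (8 * Real.exp δ)
        + (5 * A₀ + 8 * A₁ + (|gFree 0| + D₀)) * (8 * Real.exp δ)) * (1 + 2 ^ 3 * Real.exp δ) ^ (sL.length + sR.length) *
        Real.exp (-(δ / n) * supNorm u) / ((supNorm u : ℝ) + 1) ^ (2 + min (sL.length + sR.length) 1) := by
  rw [legPiece_one_entry_self]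
  have esub : (fun x y : Pt => Kinf n a (x, κ) (y, κ) - g (y - x)) = fun x y => (fun x y : Pt => Kinf n a (x, κ) (y, κ)) x y - (fun x y : Pt => g (y - x)) x y := rfl
  rw [esub, itR_sub, itL_sub]
  have hsymm : ∀ x y : Pt, Kinf n a (y, κ) (x, κ) = Kinf n a (x, κ) (y, κ) := fun x y => Kinf_symm n hn a ha (by norm_num) (y, κ) (x, κ)
  have hK := abs_itL_itR_slice_le hn hδ hA₀ hA₁ (K := fun x y => Kinf n a (x, κ) (y, κ)) (fun x => abs_Kinf_self_le hn ha x κ κ)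
    (fun x v hv => e0 x v κ κ hv) (fun x v hv ρ => e1 x v κ κ hv ρ)
    (fun y v hv => by rw [hsymm y (y + v)]; exact e0 y v κ κ hv)
    (fun y v hv ρ => by rw [hsymm y (y + v + unitVec ρ), hsymm y (y + v)]; exact e1 y v κ κ hv ρ) hsL hsR x₀ u
  have hF : |itL sL (itR sR (fun x y : Pt => g (y - x))) x₀ (x₀ + u)| ≤
      (5 * A₀ + 8 * A₁ + (|gFree 0| + D₀)) * (8 * Real.exp δ) * (1 + 2 ^ 3 * Real.exp δ) ^ (sL.length + sR.length) *
        Real.exp (-(δ / n) * supNorm u) / ((supNorm u : ℝ) + 1) ^ (2 + min (sL.length + sR.length) 1) := by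
    rw [itL_itR_transl]
    obtain ⟨hst, hlen⟩ := steps_append_neg hsL hsR
    have h := abs_iterD_far_le hn hδ hA₀ hA₁ d0 d1 h0 hst u
    rw [hlen, show sR.length + sL.length = sL.length + sR.length by omega] at h
    exact h
  refine (abs_sub _ _).trans ?_
  rw [add_mul, add_mul, add_div]
  exact add_le_add hK hF

include ha in
/-- [folklore] **PIECE 1, FLAT** (diagonal entry): `(K^∞_{κκ} − G₀) − ((g − gFree)∘(y − x))` (using `G₀ = gFree`, both even) ⇒
`|itL sL (itR sR (legPiece 1)_{κκ}) x₀ (x₀+u)| ≤ ((D₀' + D₁') + (D₀ + D₁))·2^k/n^{2+min k 1}`. -/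
theorem flat_one (hD₁ : 0 ≤ D₁) (h0 : ∀ v : Pt, |g v - gFree v| ≤ D₀ / (n : ℝ) ^ 2)
    (h1 : ∀ (v : Pt) (ρ : Fin 4), |(g (v + unitVec ρ) - gFree (v + unitVec ρ)) - (g v - gFree v)| ≤ D₁ / (n : ℝ) ^ 3)
    (κ : Fin 4) {sL sR : List Pt} (hsL : ∀ e ∈ sL, IsStep e) (hsR : ∀ e ∈ sR, IsStep e) (x₀ u : Pt) :
    |itL sL (itR sR (fun x y : Pt => legPiece n a g 1 x y κ κ)) x₀ (x₀ + u)| ≤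
      (((woodburyDc 0 + ellD0 4 a) + (woodburyD1c 0 + ellD1 4 a)) + (D₀ + D₁)) * 2 ^ (sL.length + sR.length) /
        (n : ℝ) ^ (2 + min (sL.length + sR.length) 1) := by
  rw [legPiece_one_entry_self]
  have hG : ∀ v : Pt, G₀ v = gFree v := fun v => by
    rw [← VectorLegVolumeAdapter.G₀_neg_eq_gFree, FrozenLegProfile.neg_eq_sgnVec, FrozenLegProfile.G₀_sgnVec]
  -- split the kernel: `(K − G₀∘d) − ((g − gFree)∘d)`
  have esub : (fun x y : Pt => Kinf n a (x, κ) (y, κ) - g (y - x)) =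
      fun x y => (fun x y : Pt => Kinf n a (x, κ) (y, κ) - G₀ (y - x)) x y - (fun x y : Pt => (fun v => g v - gFree v) (y - x)) x y := by
    funext x y; simp only [hG]; ring
  rw [esub, itR_sub, itL_sub]
  have hn0 : (0 : ℝ) < n := by exact_mod_cast hn
  have hD₀' : 0 ≤ woodburyDc 0 + ellD0 4 a := add_nonneg VectorLegVolumeAdapter.woodburyDc_zero_nonneg (ellD0_nonneg ha)
  have hD₁' : 0 ≤ woodburyD1c 0 + ellD1 4 a := add_nonneg VectorLegVolumeAdapter.woodburyD1c_zero_nonneg (ellD1_nonneg ha)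
  have hD₀ : 0 ≤ D₀ := by
    have h := (abs_nonneg _).trans (h0 0)
    have := mul_nonneg h (pow_nonneg hn0.le 2)
    rwa [div_mul_cancel₀ _ (by positivity)] at this
  -- part 1: the diagonal flat kernel
  have hK : |itL sL (itR sR (fun x y : Pt => Kinf n a (x, κ) (y, κ) - G₀ (y - x))) x₀ (x₀ + u)| ≤
      ((woodburyDc 0 + ellD0 4 a) + (woodburyD1c 0 + ellD1 4 a)) * 2 ^ (sL.length + sR.length) / (n : ℝ) ^ (2 + min (sL.length + sR.length) 1) := by
    rcases Nat.eq_zero_or_pos (sL.length + sR.length) with hk | hk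
    · have e1 : sL = [] := List.eq_nil_of_length_eq_zero (by omega)
      have e2 : sR = [] := List.eq_nil_of_length_eq_zero (by omega)
      subst e1; subst e2
      simp only [itL, itR, List.length_nil, add_zero, pow_zero, mul_one, Nat.min_eq_left (Nat.zero_le 1)]
      have h := abs_diagFlat_le hn ha κ x₀ (x₀ + u)
      exact h.trans (div_le_div_of_nonneg_right (by linarith) (by positivity))
    · have hmin : min (sL.length + sR.length) 1 = 1 := by omega
      rw [hmin]
      have h := abs_itL_itR_le_of_first_step (K := fun x y : Pt => Kinf n a (x, κ) (y, κ) - G₀ (y - x))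
        (M₁ := (woodburyD1c 0 + ellD1 4 a) / (n : ℝ) ^ 3) (by positivity)
        (fun x y e he => abs_diagFlat_dR_le hn ha κ x y he) (fun x y e he => abs_diagFlat_dL_le hn ha κ x y he) hsL hsR hk x₀ (x₀ + u)
      refine h.trans ?_
      rw [mul_div_assoc']
      exact div_le_div_of_nonneg_right (by nlinarith [pow_pos (two_pos : (0:ℝ) < 2) (sL.length + sR.length)]) (by positivity)
  -- part 2: the profile's flat part, a one-variable leg
  have hF : |itL sL (itR sR (fun x y : Pt => (fun v => g v - gFree v) (y - x))) x₀ (x₀ + u)| ≤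
      (D₀ + D₁) * 2 ^ (sL.length + sR.length) / (n : ℝ) ^ (2 + min (sL.length + sR.length) 1) := by
    rw [itL_itR_transl sL sR (fun v => g v - gFree v) x₀ u]
    obtain ⟨hst, hlen⟩ := steps_append_neg hsL hsR
    have h := abs_iterD_flat_le hn hD₁ h0 h1 hst u
    rw [hlen, show sR.length + sL.length = sL.length + sR.length by omega] at h
    exact h
  refine (abs_sub _ _).trans ?_
  rw [add_mul, add_div]
  exact add_le_add hK hF

end Packages

end Summit.QuantumFields.BalabanUV.Beta.D1BFx.TwoPointLegPieces
end
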